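import Summits.Ventures.LatticeQCDFlow.Exactness.IMHHotStartMSE
import HarnessLib

/-!
# A sufficient budget for flow-MCMC from arbitrary starts: `w(x₀)·log(4D²/ε²)` discarded updates per run and
# `N·R ≥ 2(2w(x₀) − 1)·Var_π f/ε²` kept configurations in total give root-mean-square accuracy `ε`

HONEST FRAMING: exact (Metropolis-corrected) sampling algorithms for lattice gauge theory;
figures of merit are autocorrelation/cost numbers at stated couplings and volumes; no
continuum-physics claim.

Venture `LatticeQCDFlow` (cell pub-lqcd), topic `Exactness`; FANOUT row 30 (lean-1, GEN-35).  NEW WORK of the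
cell, general state space.  `K = indepMH q w` (normalised weight `w` maximal at `x₀`, `W = w(x₀) = 1/A`, `r = 1 − A`);
`a ≤ f ≤ c`, `V = Var_π f`, `D = max(π f − a, c − π f)`.  This generation's error laws (`Exactness/IMHAnyStartMSE`:
one run from any start `MSE_{μ₀}(N; b) ≤ (2W − 1)V/N + r^b D²`; `…IMHAnyStartReplicas`: `R` pairwise independent runs
`E(Ȳ − π f)² ≤ [(2W − 1)V/N + r^b D²]/R + (1 − 1/R)(D r^b min(1, W/N))²`; `…IMHHotStartMSE`: hot starts carry
`r^{b+1}`) are turned into A PLANNING RULE with the sampler's three constants `W`, `V`, `D`: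

* §1 **`pow_mode_le_of_budget`** — `W·log(4D²/ε²) ≤ b ⇒ r^b·D² ≤ ε²/4` (`0 < ε`).
* §2 **`imh_chain_windowMSE_anyStart_le_of_budget`** — ONE RUN FROM ANY START: if `W·log(4D²/ε²) ≤ b` and
  `2(2W − 1)·V ≤ ε²·N` then `E_{μ₀}[(A_{N,b} − π f)²] ≤ ε²` (indeed `≤ 3ε²/4`).
* §3 **`imh_replicas_anyStart_mse_le_of_budget`** — `R` PAIRWISE INDEPENDENT RUNS FROM ARBITRARY STARTS: if
  `W·log(4D²/ε²) ≤ b` and `2(2W − 1)·V ≤ ε²·N·R`, then `E(Ȳ − π f)² ≤ ε²` — THE DISCARDS ARE PAID PER RUN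
  (`b` does not shrink with `R`), THE KEPT BUDGET `N·R` IS SHARED.
* §4 **`imh_replicas_hotStart_mse_le_of_budget`** — HOT-STARTED RUNS (each from a draw of the proposal): the same
  with `W·log(4D²/ε²) ≤ b + 1` — one discard fewer per run.

Reading (gauge files `Scaling/AutoregressiveGauge…ReplicaBudget`): an exact gauge sampler with cold acceptance `A`:
`(1/A)·log(4D²/ε²)` discarded configurations per run (one fewer from a hot start) and `2(2/A − 1)·Var_π f/ε²` kept
configurations in total, over any number of pairwise independent runs, certify root-mean-square accuracy `ε` for
`π f`; the total cost `R·b + N·R` carries the burn-in `R` times.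
NOT CLAIMED: necessity of these budgets (GEN-32's necessary per-replica length is the cold start's); optimal
allocation between `R` and `N`; any value of `A`, `V`, `D`.  No `sorry`, no new definitions, nothing cited as a fact.
-/

noncomputable section

namespace Summit.Ventures.LatticeQCDFlow.Exactness

open MeasureTheory ProbabilityTheory Function Finset
open scoped ENNReal
open Summit.Ventures.LatticeQCDFlow.Scoring

variable {Ω : Type*} [MeasurableSpace Ω] {q : Measure Ω} [IsProbabilityMeasure q] {w : Ω → ℝ}

/-! ## §1 The discard budget -/

/-- **`W·log(4D²/ε²) ≤ b ⇒ r^b·D² ≤ ε²/4`** (`w` normalised, maximal at `x₀`, `W = w(x₀)`; `0 < ε`; any real `D`).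
[ours] -/
theorem pow_mode_le_of_budget {x₀ : Ω} (hmax : ∀ y, w y ≤ w x₀) (hw0 : ∀ y, 0 < w y)
    [IsProbabilityMeasure (q.withDensity fun y => ENNReal.ofReal (w y))] {b : ℕ} {ε D : ℝ} (hε : 0 < ε)
    (hb : w x₀ * Real.log (4 * D ^ 2 / ε ^ 2) ≤ b) : (1 - (w x₀)⁻¹) ^ b * D ^ 2 ≤ ε ^ 2 / 4 := by
  have hWpos : 0 < w x₀ := hw0 x₀
  have hW : 1 ≤ w x₀ := one_le_of_mode (q := q) hmax
  have hr0 : 0 ≤ (1 - (w x₀)⁻¹) ^ b := pow_nonneg (sub_nonneg.2 (inv_le_one_of_one_le₀ hW)) b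
  have hr1 : (1 - (w x₀)⁻¹) ^ b ≤ 1 :=
    pow_le_one₀ (sub_nonneg.2 (inv_le_one_of_one_le₀ hW)) (sub_le_self _ (inv_nonneg.2 hWpos.le))
  rcases eq_or_lt_of_le (sq_nonneg D) with hD | hD
  · rw [← hD, mul_zero]; positivity
  · -- `δ = ε²/(4D²) > 0` and `log(1/δ) ≤ b/W`
    have hδ : 0 < ε ^ 2 / (4 * D ^ 2) := by positivity
    have hb' : Real.log (1 / (ε ^ 2 / (4 * D ^ 2))) ≤ b * (w x₀)⁻¹ := by
      rw [one_div, inv_div, le_mul_inv_iff₀ hWpos, mul_comm]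
      exact hb
    have h := pow_mode_le_of_log_le (q := q) hmax hδ hb'
    have hDne : D ^ 2 ≠ 0 := hD.ne'
    calc (1 - (w x₀)⁻¹) ^ b * D ^ 2 ≤ ε ^ 2 / (4 * D ^ 2) * D ^ 2 := mul_le_mul_of_nonneg_right h (sq_nonneg D)
      _ = ε ^ 2 / 4 := by rw [div_mul_eq_mul_div, mul_comm (ε ^ 2), mul_comm (4 : ℝ), mul_div_mul_left _ _ hDne]

/-! ## §2 One run from any start -/

/-- **ONE RUN FROM ANY START**: `W·log(4D²/ε²) ≤ b` discards and `2(2W − 1)·V ≤ ε²·N` kept updates give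
`E_{μ₀}[(A_{N,b} − π f)²] ≤ ε²`, for every initial law. [ours] -/
theorem imh_chain_windowMSE_anyStart_le_of_budget [Fact (Measurable w)] (hw0 : ∀ y, 0 < w y) {x₀ : Ω}
    (hmax : ∀ y, w y ≤ w x₀) [IsProbabilityMeasure (q.withDensity fun y => ENNReal.ofReal (w y))]
    (μ₀ : Measure Ω) [IsProbabilityMeasure μ₀] {f : Ω → ℝ} (hf : Measurable f) {a c : ℝ}
    (ha : ∀ x, a ≤ f x) (hc : ∀ x, f x ≤ c) {b N : ℕ} (hN : N ≠ 0) {ε : ℝ} (hε : 0 < ε)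
    (hb : w x₀ * Real.log (4 * (max (∫ z, f z ∂(q.withDensity fun y => ENNReal.ofReal (w y)) - a)
      (c - ∫ z, f z ∂(q.withDensity fun y => ENNReal.ofReal (w y)))) ^ 2 / ε ^ 2) ≤ b)
    (hNε : 2 * (2 * w x₀ - 1) * ∫ x, (f x - ∫ z, f z ∂(q.withDensity fun y => ENNReal.ofReal (w y))) ^ 2
      ∂(q.withDensity fun y => ENNReal.ofReal (w y)) ≤ ε ^ 2 * N) :
    ∫ x, ((∑ i ∈ range N, f (x (b + i))) / N - ∫ z, f z ∂(q.withDensity fun y => ENNReal.ofReal (w y))) ^ 2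
        ∂(Kernel.trajMeasure (X := fun _ : ℕ => Ω) μ₀
          (fun n : ℕ => (indepMH q w).comap (fun h : (i : ↥(Finset.Iic n)) → Ω => h ⟨n, Finset.mem_Iic.2 le_rfl⟩)
            (measurable_pi_apply _))) ≤ ε ^ 2 := by
  have h1 := imh_chain_windowMSE_anyStart_le_explicit (q := q) hw0 hmax μ₀ hf ha hc b hN (x₀ := x₀)
  have h2 := pow_mode_le_of_budget (q := q) hmax hw0 hε hb
  have hNpos : (0 : ℝ) < N := by exact_mod_cast Nat.pos_of_ne_zero hN
  have h3 : (2 * w x₀ - 1) * (∫ x, (f x - ∫ z, f z ∂(q.withDensity fun y => ENNReal.ofReal (w y))) ^ 2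
      ∂(q.withDensity fun y => ENNReal.ofReal (w y))) / N ≤ ε ^ 2 / 2 := by
    rw [div_le_iff₀ hNpos]; linarith
  have hε2 : 0 < ε ^ 2 := by positivity
  linarith

/-! ## §3 Pairwise independent runs from arbitrary starts -/

section Replicas

variable {Ω' : Type*} {mΩ' : MeasurableSpace Ω'} {μ : Measure Ω'} [IsProbabilityMeasure μ]
  {X : ℕ → Ω' → (ℕ → Ω)} {μ₀ : ℕ → Measure Ω} [∀ j, IsProbabilityMeasure (μ₀ j)] {R : ℕ}

/-- **`R` RUNS FROM ARBITRARY STARTS**: `W·log(4D²/ε²) ≤ b` discards PER RUN, `2(2W − 1)·V ≤ ε²·N·R` kept updates IN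
TOTAL: then `E(Ȳ − π f)² ≤ ε²` for pairwise independent runs started anywhere. [ours] -/
theorem imh_replicas_anyStart_mse_le_of_budget [Fact (Measurable w)] (hw0 : ∀ y, 0 < w y) {x₀ : Ω}
    (hmax : ∀ y, w y ≤ w x₀) [IsProbabilityMeasure (q.withDensity fun y => ENNReal.ofReal (w y))]
    {f : Ω → ℝ} (hf : Measurable f) {a c : ℝ} (ha : ∀ x, a ≤ f x) (hc : ∀ x, f x ≤ c) {b N : ℕ}
    (hN : N ≠ 0) (hR : R ≠ 0) (hXm : ∀ j, Measurable (X j))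
    (hlaw : ∀ j < R, μ.map (X j) = Kernel.trajMeasure (X := fun _ : ℕ => Ω) (μ₀ j)
      (fun n : ℕ => (indepMH q w).comap (fun h : (i : ↥(Finset.Iic n)) → Ω => h ⟨n, Finset.mem_Iic.2 le_rfl⟩)
        (measurable_pi_apply _)))
    (hind : ∀ i < R, ∀ j < R, i ≠ j → IndepFun (X i) (X j) μ) {ε : ℝ} (hε : 0 < ε)
    (hb : w x₀ * Real.log (4 * (max (∫ z, f z ∂(q.withDensity fun y => ENNReal.ofReal (w y)) - a)
      (c - ∫ z, f z ∂(q.withDensity fun y => ENNReal.ofReal (w y)))) ^ 2 / ε ^ 2) ≤ b)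
    (hNε : 2 * (2 * w x₀ - 1) * ∫ x, (f x - ∫ z, f z ∂(q.withDensity fun y => ENNReal.ofReal (w y))) ^ 2
      ∂(q.withDensity fun y => ENNReal.ofReal (w y)) ≤ ε ^ 2 * (N * R)) :
    ∫ ω, (replicaMean (fun j ω => (∑ i ∈ range N, f (X j ω (b + i))) / N) R ω -
        ∫ z, f z ∂(q.withDensity fun y => ENNReal.ofReal (w y))) ^ 2 ∂μ ≤ ε ^ 2 := by
  have h1 := imh_replicas_anyStart_mse_le_explicit (q := q) hw0 hmax hf ha hc b hN hR hXm hlaw hind (x₀ := x₀)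
  set m := ∫ z, f z ∂(q.withDensity fun y => ENNReal.ofReal (w y)) with hm
  set D := max (m - a) (c - m) with hD
  set V := ∫ x, (f x - m) ^ 2 ∂(q.withDensity fun y => ENNReal.ofReal (w y)) with hV
  have h2 := pow_mode_le_of_budget (q := q) (D := D) hmax hw0 hε hb
  have hNpos : (0 : ℝ) < N := by exact_mod_cast Nat.pos_of_ne_zero hN
  have hRpos : (0 : ℝ) < R := by exact_mod_cast Nat.pos_of_ne_zero hR
  have hR1 : (1 : ℝ) ≤ R := by exact_mod_cast Nat.one_le_iff_ne_zero.2 hR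
  have hW : 1 ≤ w x₀ := one_le_of_mode (q := q) hmax
  have hrb : 0 ≤ (1 - (w x₀)⁻¹) ^ b := pow_nonneg (sub_nonneg.2 (inv_le_one_of_one_le₀ hW)) b
  have hD0 : 0 ≤ D := by
    rcases le_total m a with h | h
    · exact le_max_of_le_right (by linarith [(ha x₀).trans (hc x₀)])
    · exact le_max_of_le_left (by linarith)
  have hmin1 : min 1 (w x₀ / N) ≤ 1 := min_le_left _ _
  have hmin0 : 0 ≤ min 1 (w x₀ / N) := le_min zero_le_one (div_nonneg (hw0 x₀).le hNpos.le)
  -- variance part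
  have hvar : (2 * w x₀ - 1) * V / N / R ≤ ε ^ 2 / 2 := by
    rw [div_div, div_le_iff₀ (mul_pos hNpos hRpos)]; linarith
  -- start part inside the `1/R` bracket
  have hstart : (1 - (w x₀)⁻¹) ^ b * D ^ 2 / R ≤ ε ^ 2 / 4 :=
    (div_le_self (mul_nonneg hrb (sq_nonneg D)) hR1).trans h2
  -- squared bias part: `(D r^b min)² ≤ (r^b D²)·(r^b) ≤ ε²/4 · 1`
  have hbias : (1 - 1 / (R : ℝ)) * (D * ((1 - (w x₀)⁻¹) ^ b * min 1 (w x₀ / N))) ^ 2 ≤ ε ^ 2 / 4 := by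
    have hle1 : 1 - 1 / (R : ℝ) ≤ 1 := sub_le_self _ (by positivity)
    have hge0 : 0 ≤ 1 - 1 / (R : ℝ) := by rw [sub_nonneg, div_le_one hRpos]; exact hR1
    have hsq : (D * ((1 - (w x₀)⁻¹) ^ b * min 1 (w x₀ / N))) ^ 2 ≤ (1 - (w x₀)⁻¹) ^ b * D ^ 2 := by
      have hr1 : (1 - (w x₀)⁻¹) ^ b ≤ 1 :=
        pow_le_one₀ (sub_nonneg.2 (inv_le_one_of_one_le₀ hW)) (sub_le_self _ (inv_nonneg.2 (hw0 x₀).le))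
      have e : (D * ((1 - (w x₀)⁻¹) ^ b * min 1 (w x₀ / N))) ^ 2 =
          (1 - (w x₀)⁻¹) ^ b * D ^ 2 * ((1 - (w x₀)⁻¹) ^ b * (min 1 (w x₀ / N)) ^ 2) := by ring
      rw [e]
      refine mul_le_of_le_one_right (mul_nonneg hrb (sq_nonneg D)) ?_
      calc (1 - (w x₀)⁻¹) ^ b * (min 1 (w x₀ / N)) ^ 2 ≤ 1 * 1 :=
            mul_le_mul hr1 (by nlinarith) (sq_nonneg _) zero_le_one
        _ = 1 := one_mul 1
    calc (1 - 1 / (R : ℝ)) * (D * ((1 - (w x₀)⁻¹) ^ b * min 1 (w x₀ / N))) ^ 2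
        ≤ 1 * ((1 - (w x₀)⁻¹) ^ b * D ^ 2) := mul_le_mul hle1 hsq (sq_nonneg _) zero_le_one
      _ ≤ ε ^ 2 / 4 := by rw [one_mul]; exact h2
  have hsplit : ((2 * w x₀ - 1) * V / N + (1 - (w x₀)⁻¹) ^ b * D ^ 2) / R =
      (2 * w x₀ - 1) * V / N / R + (1 - (w x₀)⁻¹) ^ b * D ^ 2 / R := by rw [add_div]
  rw [hsplit] at h1
  have hε2 : 0 < ε ^ 2 := by positivity
  linarith

end Replicas

/-! ## §4 Hot-started runs: one discard fewer -/

section Hot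

variable {Ω' : Type*} {mΩ' : MeasurableSpace Ω'} {μ : Measure Ω'} [IsProbabilityMeasure μ]
  {X : ℕ → Ω' → (ℕ → Ω)} {R : ℕ}

/-- **HOT-STARTED RUNS**: `W·log(4D²/ε²) ≤ b + 1`, `2(2W − 1)·V ≤ ε²·N·R` ⇒ `E(Ȳ − π f)² ≤ ε²` for pairwise
independent runs each started from a draw of the proposal. [ours] -/
theorem imh_replicas_hotStart_mse_le_of_budget [Fact (Measurable w)] (hw0 : ∀ y, 0 < w y) {x₀ : Ω}
    (hmax : ∀ y, w y ≤ w x₀) [IsProbabilityMeasure (q.withDensity fun y => ENNReal.ofReal (w y))]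
    {f : Ω → ℝ} (hf : Measurable f) {a c : ℝ} (ha : ∀ x, a ≤ f x) (hc : ∀ x, f x ≤ c) {b N : ℕ}
    (hN : N ≠ 0) (hR : R ≠ 0) (hXm : ∀ j, Measurable (X j))
    (hlaw : ∀ j < R, μ.map (X j) = Kernel.trajMeasure (X := fun _ : ℕ => Ω) q
      (fun n : ℕ => (indepMH q w).comap (fun h : (i : ↥(Finset.Iic n)) → Ω => h ⟨n, Finset.mem_Iic.2 le_rfl⟩)
        (measurable_pi_apply _)))
    (hind : ∀ i < R, ∀ j < R, i ≠ j → IndepFun (X i) (X j) μ) {ε : ℝ} (hε : 0 < ε)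
    (hb : w x₀ * Real.log (4 * (max (∫ z, f z ∂(q.withDensity fun y => ENNReal.ofReal (w y)) - a)
      (c - ∫ z, f z ∂(q.withDensity fun y => ENNReal.ofReal (w y)))) ^ 2 / ε ^ 2) ≤ (b + 1 : ℕ))
    (hNε : 2 * (2 * w x₀ - 1) * ∫ x, (f x - ∫ z, f z ∂(q.withDensity fun y => ENNReal.ofReal (w y))) ^ 2
      ∂(q.withDensity fun y => ENNReal.ofReal (w y)) ≤ ε ^ 2 * (N * R)) :
    ∫ ω, (replicaMean (fun j ω => (∑ i ∈ range N, f (X j ω (b + i))) / N) R ω -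
        ∫ z, f z ∂(q.withDensity fun y => ENNReal.ofReal (w y))) ^ 2 ∂μ ≤ ε ^ 2 := by
  have h1 := imh_replicas_hotStart_mse_le_explicit (q := q) hw0 hmax hf ha hc b hN hR hXm hlaw hind (x₀ := x₀)
  set m := ∫ z, f z ∂(q.withDensity fun y => ENNReal.ofReal (w y)) with hm
  set D := max (m - a) (c - m) with hD
  set V := ∫ x, (f x - m) ^ 2 ∂(q.withDensity fun y => ENNReal.ofReal (w y)) with hV
  have h2 := pow_mode_le_of_budget (q := q) (D := D) hmax hw0 hε hb
  have hNpos : (0 : ℝ) < N := by exact_mod_cast Nat.pos_of_ne_zero hN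
  have hRpos : (0 : ℝ) < R := by exact_mod_cast Nat.pos_of_ne_zero hR
  have hR1 : (1 : ℝ) ≤ R := by exact_mod_cast Nat.one_le_iff_ne_zero.2 hR
  have hW : 1 ≤ w x₀ := one_le_of_mode (q := q) hmax
  have hrb : 0 ≤ (1 - (w x₀)⁻¹) ^ (b + 1) := pow_nonneg (sub_nonneg.2 (inv_le_one_of_one_le₀ hW)) _
  have hmin0 : 0 ≤ min 1 (w x₀ / N) := le_min zero_le_one (div_nonneg (hw0 x₀).le hNpos.le)
  have hvar : (2 * w x₀ - 1) * V / N / R ≤ ε ^ 2 / 2 := by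
    rw [div_div, div_le_iff₀ (mul_pos hNpos hRpos)]; linarith
  have hstart : (1 - (w x₀)⁻¹) ^ (b + 1) * D ^ 2 / R ≤ ε ^ 2 / 4 :=
    (div_le_self (mul_nonneg hrb (sq_nonneg D)) hR1).trans h2
  have hbias : (1 - 1 / (R : ℝ)) * (D * ((1 - (w x₀)⁻¹) ^ (b + 1) * min 1 (w x₀ / N))) ^ 2 ≤ ε ^ 2 / 4 := by
    have hle1 : 1 - 1 / (R : ℝ) ≤ 1 := sub_le_self _ (by positivity)
    have hsq : (D * ((1 - (w x₀)⁻¹) ^ (b + 1) * min 1 (w x₀ / N))) ^ 2 ≤ (1 - (w x₀)⁻¹) ^ (b + 1) * D ^ 2 := by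
      have hr1 : (1 - (w x₀)⁻¹) ^ (b + 1) ≤ 1 :=
        pow_le_one₀ (sub_nonneg.2 (inv_le_one_of_one_le₀ hW)) (sub_le_self _ (inv_nonneg.2 (hw0 x₀).le))
      have e : (D * ((1 - (w x₀)⁻¹) ^ (b + 1) * min 1 (w x₀ / N))) ^ 2 =
          (1 - (w x₀)⁻¹) ^ (b + 1) * D ^ 2 * ((1 - (w x₀)⁻¹) ^ (b + 1) * (min 1 (w x₀ / N)) ^ 2) := by ring
      rw [e]
      refine mul_le_of_le_one_right (mul_nonneg hrb (sq_nonneg D)) ?_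
      calc (1 - (w x₀)⁻¹) ^ (b + 1) * (min 1 (w x₀ / N)) ^ 2 ≤ 1 * 1 :=
            mul_le_mul hr1 (by nlinarith [min_le_left (1 : ℝ) (w x₀ / N)]) (sq_nonneg _) zero_le_one
        _ = 1 := one_mul 1
    calc (1 - 1 / (R : ℝ)) * (D * ((1 - (w x₀)⁻¹) ^ (b + 1) * min 1 (w x₀ / N))) ^ 2
        ≤ 1 * ((1 - (w x₀)⁻¹) ^ (b + 1) * D ^ 2) := mul_le_mul hle1 hsq (sq_nonneg _) zero_le_one
      _ ≤ ε ^ 2 / 4 := by rw [one_mul]; exact h2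
  have hsplit : ((2 * w x₀ - 1) * V / N + (1 - (w x₀)⁻¹) ^ (b + 1) * D ^ 2) / R =
      (2 * w x₀ - 1) * V / N / R + (1 - (w x₀)⁻¹) ^ (b + 1) * D ^ 2 / R := by rw [add_div]
  rw [hsplit] at h1
  have hε2 : 0 < ε ^ 2 := by positivity
  linarith

end Hot

end Summit.Ventures.LatticeQCDFlow.Exactness
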